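import Mathlib
import Literature.Probability.Percolation.LoopRebasing
import Literature.Probability.Percolation.TypedTriLoopCollections
import Literature.Probability.RandomPlanarGeometry.CurveMonotoneReparam
import Literature.Probability.Percolation.CLE6
import Summits.CriticalPhenomena.CardyFormulaZ2.Theorems.CardyMagicRigidityHexSegmentDefs
import HarnessLib

/-!
# Stub `stub_siteEnd` (S2) of line `Sketch`, crux `LoopLimitZ2EqT` (stmt-CriticalPhenomena-4833):
# the discrete Fréchet bound (metric packaging for the fellow-travelling of two lattice loops)

Helper file (`--supports stmt-CriticalPhenomena-4833`): generic curve-space lemmas for the metric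
core (M1)/(M0) of the loop dictionary (`CardyMagicRigidityLoopLimitZ2EqTSiteEndDictionary.lean`),
where a coarse honeycomb interface loop (mesh `δ`) and the fine interface loop tracking it (mesh
`δ/2`) — two closed walks of DIFFERENT lengths — must be shown `d`-close
(`UnbasedLoop.udist`, DKKMO eq. (1)):

* `siteEnd_dist_lineMap_lineMap_le`, `siteEnd_dist_affineInterp_le` — two affine interpolations
  (`affineInterp`, `LoopRebasing.lean`) through equally many pairwise `r`-close knots are
  `r`-close at every time; `siteEnd_affineInterp_monotone` — interpolation through nondecreasing
  real knots is monotone (used as a clock);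
* **`siteEnd_mk_polyline_stutter`** — **stutter invariance**: traversing the knots of `L` along a
  unit-step index sequence `i 0 = 0, …, i K = |L| - 1` (repeat or advance) gives the same curve
  class as `polyline L` (`mk_polyline_eq_mk_uniformCurve` and
  `Curve.reparamDist_eq_zero_of_monotone'` with the piecewise-affine clock through the `i k`);
* **`siteEnd_dist_mk_polyline_le_of_coupling`** — **the discrete Fréchet bound**: two polylines
  whose knots can be traversed simultaneously by unit-step index sequences keeping the current
  knots `r`-close are `r`-close as curve classes;
* **`siteEnd_udist_siteLoopCurve_le_of_coupling`** — the same for the unbased loops of two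
  closed honeycomb walks drawn at two meshes (`siteLoopCurve`; `udist ≤` distance of curve
  classes, `udist_mk_mk_le_dist`): the prover of (M1)/(M0) only has to produce the
  combinatorial coupling of the two face sequences with `O(δ)`-close rescaled face centres.
-/

noncomputable section

open Set Metric

namespace Summit.CriticalPhenomena.CardyFormulaZ2.Cruxes.LoopLimitZ2EqT.HexSegment

open Literature.Probability.Percolation Literature.Probability.LatticeModels
  Literature.Probability.RandomPlanarGeometry
open scoped unitInterval

section Interp

variable {E : Type*} [NormedAddCommGroup E] [NormedSpace ℝ E]

/-! ### Two affine interpolations with close knots are close -/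

/-- Convex combinations with the same weight of two pairs of `r`-close points are `r`-close. -/
theorem siteEnd_dist_lineMap_lineMap_le {a b a' b' : E} {r s : ℝ} (hs : s ∈ Icc (0 : ℝ) 1)
    (ha : dist a a' ≤ r) (hb : dist b b' ≤ r) :
    dist (AffineMap.lineMap a b s) (AffineMap.lineMap a' b' s) ≤ r := by
  rw [AffineMap.lineMap_apply_module, AffineMap.lineMap_apply_module, dist_eq_norm]
  have e : (1 - s) • a + s • b - ((1 - s) • a' + s • b') = (1 - s) • (a - a') + s • (b - b') := by
    simp only [smul_sub]; abel
  rw [e]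
  calc ‖(1 - s) • (a - a') + s • (b - b')‖ ≤ ‖(1 - s) • (a - a')‖ + ‖s • (b - b')‖ := norm_add_le _ _
    _ = (1 - s) * dist a a' + s * dist b b' := by
        rw [norm_smul, norm_smul, Real.norm_of_nonneg (by linarith [hs.2]), Real.norm_of_nonneg hs.1,
          dist_eq_norm, dist_eq_norm]
    _ ≤ (1 - s) * r + s * r := add_le_add (mul_le_mul_of_nonneg_left ha (by linarith [hs.2]))
          (mul_le_mul_of_nonneg_left hb hs.1)
    _ = r := by ring

/-- **Affine interpolations through equally many pairwise `r`-close knots are `r`-close at every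
nonnegative time.** -/
theorem siteEnd_dist_affineInterp_le : ∀ (L L' : List E), L.length = L'.length → ∀ {r : ℝ}, 0 ≤ r →
    (∀ (i : ℕ) (hi : i < L.length) (hi' : i < L'.length), dist L[i] L'[i] ≤ r) →
    ∀ {s : ℝ}, 0 ≤ s → dist (affineInterp L s) (affineInterp L' s) ≤ r
  | [], [], _, r, hr, _, s, _ => by simpa [affineInterp] using hr
  | [], _ :: _, h, _, _, _, _, _ => by simp at h
  | _ :: _, [], h, _, _, _, _, _ => by simp at h
  | [a], [a'], _, r, _, h, s, _ => by simpa using h 0 (by simp) (by simp)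
  | [_], _ :: _ :: _, h, _, _, _, _, _ => by simp at h
  | _ :: _ :: _, [_], h, _, _, _, _, _ => by simp at h
  | a :: b :: l, a' :: b' :: l', hlen, r, hr, h, s, hs => by
      rw [affineInterp_cons_cons, affineInterp_cons_cons]
      have hab : dist a a' ≤ r := h 0 (by simp) (by simp)
      have hbb : dist b b' ≤ r := h 1 (by simp) (by simp)
      split_ifs with h1
      · exact siteEnd_dist_lineMap_lineMap_le ⟨hs, h1⟩ hab hbb
      · refine siteEnd_dist_affineInterp_le (b :: l) (b' :: l') (by simpa using hlen) hr
          (fun i hi hi' => ?_) (by linarith [not_le.1 h1])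
        have := h (i + 1) (by simpa using hi) (by simpa using hi')
        simpa using this

/-- An affine interpolation through nondecreasing real knots is monotone. -/
theorem siteEnd_affineInterp_monotone : ∀ (L : List ℝ),
    (∀ (i : ℕ) (hi : i + 1 < L.length), L[i] ≤ L[i + 1]) → Monotone (affineInterp L)
  | [], _ => fun _ _ _ => le_rfl
  | [a], _ => fun _ _ _ => le_rfl
  | a :: b :: l, h => by
      have hab : a ≤ b := h 0 (by simp)
      have ih : Monotone (affineInterp (b :: l)) :=
        siteEnd_affineInterp_monotone (b :: l) fun i hi => h (i + 1) (by simpa using hi)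
      have hseg : ∀ {s t : ℝ}, s ≤ t → AffineMap.lineMap a b s ≤ AffineMap.lineMap a b t := by
        intro s t hst
        simp only [AffineMap.lineMap_apply_module, smul_eq_mul]
        nlinarith
      have hone : AffineMap.lineMap a b (1 : ℝ) = affineInterp (b :: l) 0 := by simp
      intro s t hst
      rw [affineInterp_cons_cons, affineInterp_cons_cons]
      by_cases hs1 : s ≤ 1
      · by_cases ht1 : t ≤ 1
        · rw [if_pos hs1, if_pos ht1]; exact hseg hst
        · rw [if_pos hs1, if_neg ht1]
          calc AffineMap.lineMap a b s ≤ AffineMap.lineMap a b (1 : ℝ) := hseg hs1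
            _ = affineInterp (b :: l) 0 := hone
            _ ≤ affineInterp (b :: l) (t - 1) := ih (by linarith [not_le.1 ht1])
      · have ht1 : ¬ t ≤ 1 := fun ht1 => hs1 (hst.trans ht1)
        rw [if_neg hs1, if_neg ht1]
        exact ih (by linarith)

/-! ### Stuttering the knots does not change the curve class -/

/-- **Stutter invariance.** Traversing the knots of `L` along a surjective unit-step index
sequence `i 0 = 0, …, i K = length L - 1` (each step repeats the current knot or moves to the
next) gives the same polyline as a curve class: both are monotone traversals of the affine
interpolation through `L` (`Curve.reparamDist_eq_zero_of_monotone'`), the stuttered one with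
the piecewise-affine clock through the knots `i k`. -/
theorem siteEnd_mk_polyline_stutter {L : List E} (hL : L ≠ []) {K : ℕ} {i : ℕ → ℕ}
    (hi0 : i 0 = 0) (hiK : i K = L.length - 1)
    (hstep : ∀ k < K, i (k + 1) = i k ∨ i (k + 1) = i k + 1) (hlt : ∀ k ≤ K, i k < L.length) :
    CurveClass.mk ⟨polyline L⟩ =
      CurveClass.mk ⟨polyline (List.ofFn fun k : Fin (K + 1) => L[i k]'(hlt k (Nat.lt_succ_iff.1 k.2)))⟩ := by
  set F : Fin (K + 1) → E := fun k => L[i k]'(hlt k (Nat.lt_succ_iff.1 k.2)) with hF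
  have hL'len : (List.ofFn F).length = K + 1 := List.length_ofFn
  have hL'get : ∀ (k : ℕ) (hk : k < (List.ofFn F).length),
      (List.ofFn F)[k] = L[i k]'(hlt k (by rw [hL'len] at hk; omega)) := by
    intro k hk
    rw [List.getElem_ofFn]
  -- monotonicity of the index sequence
  have himono : ∀ k ≤ K, ∀ k' ≤ k, i k' ≤ i k := by
    intro k hk k' hk'
    induction k with
    | zero => rw [Nat.le_zero.1 hk']
    | succ k ih =>
      rcases Nat.lt_or_ge k' (k + 1) with hlt' | hge
      · have := ih (by omega) (by omega)
        rcases hstep k (by omega) with h | h <;> omega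
      · rw [le_antisymm hk' hge]
  rw [mk_polyline_eq_mk_uniformCurve, mk_polyline_eq_mk_uniformCurve,
    CurveClass.mk_eq_mk_iff_dist_eq_zero, Curve.dist_def]
  -- the clock through the knots `i k`
  set G : Fin (K + 1) → ℝ := fun k => (i k : ℝ) with hG
  set J : List ℝ := List.ofFn G with hJ
  have hJlen : J.length = K + 1 := by rw [hJ]; exact List.length_ofFn
  have hJget : ∀ (k : ℕ) (hk : k < J.length), J[k] = (i k : ℝ) := by
    intro k hk
    have : J[k] = (List.ofFn G)[k]'(by rw [← hJ]; exact hk) := by simp only [hJ]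
    rw [this, List.getElem_ofFn]
  set m : ℝ := (L.length : ℝ) - 1 with hm
  have hlen1 : 1 ≤ L.length := List.length_pos_iff.2 hL
  have hm0 : 0 ≤ m := by
    have : (1 : ℝ) ≤ L.length := by exact_mod_cast hlen1
    rw [hm]; linarith
  have hiKr : (i K : ℝ) = m := by
    rw [hiK, hm, Nat.cast_sub hlen1, Nat.cast_one]
  refine Curve.reparamDist_eq_zero_of_monotone' hm0 (V := affineInterp L)
    (continuous_affineInterp L).continuousOn (h₁ := fun t => m * t)
    (h₂ := fun t => affineInterp J (K * t)) (by fun_prop)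
    ((continuous_affineInterp J).comp (by fun_prop)) (fun s t hst => by
      simp only; exact mul_le_mul_of_nonneg_left hst hm0)
    ((siteEnd_affineInterp_monotone J fun k hk => by
        rw [hJget, hJget]; rw [hJlen] at hk
        exact_mod_cast himono (k + 1) (by omega) k (by omega)).comp
      fun s t hst => mul_le_mul_of_nonneg_left hst (Nat.cast_nonneg K))
    (by simp) (by
      simp only [mul_zero]
      have := affineInterp_natCast J 0 (by rw [hJlen]; omega)
      rw [Nat.cast_zero] at this
      rw [this, hJget, hi0, Nat.cast_zero])
    (by simp) (by
      simp only [mul_one]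
      rw [affineInterp_natCast J K (by rw [hJlen]; omega), hJget, hiKr])
    (fun t => by simp [uniformCurve_apply, hm]) fun t => ?_
  -- the stuttered uniform polyline is the original interpolation run with the clock
  rw [uniformCurve_apply, hL'len]
  push_cast
  rw [add_sub_cancel_right]
  -- write `K t = k + u` with `u ∈ [0, 1]`
  have hKt0 : 0 ≤ (K : ℝ) * t := mul_nonneg (Nat.cast_nonneg K) t.2.1
  have hKt1 : (K : ℝ) * t ≤ K := by have := t.2.2; nlinarith [Nat.cast_nonneg (α := ℝ) K]
  rcases Nat.eq_zero_or_pos K with hK0 | hKpos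
  · -- no segment: everything is constant
    subst hK0
    have hlen0 : L.length = 1 := by have := hlt 0 le_rfl; rw [hi0] at this; omega
    obtain ⟨a, rfl⟩ : ∃ a, L = [a] := by
      match L, hlen0 with
      | [a], _ => exact ⟨a, rfl⟩
    simp [hF, hi0, affineInterp]
  set k : ℕ := min (⌊(K : ℝ) * t⌋₊) (K - 1) with hk
  have hkK : k < K := by rw [hk]; omega
  have hk_le : (k : ℝ) ≤ K * t := by
    have h1 : (k : ℝ) ≤ ⌊(K : ℝ) * t⌋₊ := by exact_mod_cast min_le_left _ _
    exact h1.trans (Nat.floor_le hKt0)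
  have hk_ge : (K : ℝ) * t ≤ k + 1 := by
    rcases lt_or_ge (⌊(K : ℝ) * t⌋₊) (K - 1) with h | h
    · have : k = ⌊(K : ℝ) * t⌋₊ := by rw [hk]; exact min_eq_left h.le
      rw [this]; exact (Nat.lt_floor_add_one _).le
    · have : k = K - 1 := by rw [hk]; exact min_eq_right h
      rw [this, Nat.cast_sub (by omega), Nat.cast_one, sub_add_cancel]; exact hKt1
  have hmem : (K : ℝ) * t ∈ Icc (k : ℝ) (k + 1) := ⟨hk_le, hk_ge⟩
  rw [affineInterp_eq_lineMap (List.ofFn F) k (by rw [hL'len]; omega) hmem,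
    affineInterp_eq_lineMap J k (by rw [hJlen]; omega) hmem, hL'get, hL'get, hJget, hJget]
  set u : ℝ := (K : ℝ) * t - k with hu
  have hu01 : u ∈ Icc (0 : ℝ) 1 := ⟨by rw [hu]; linarith, by rw [hu]; linarith⟩
  rcases hstep k hkK with hsame | hnext
  · -- stutter: both sides are the knot `L[i k]`
    have e1 : AffineMap.lineMap (i k : ℝ) (i (k + 1) : ℝ) u = (i k : ℝ) := by
      rw [hsame, AffineMap.lineMap_same_apply]
    rw [e1, affineInterp_natCast L (i k) (hlt k hkK.le)]
    simp only [hsame, AffineMap.lineMap_same_apply]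
  · -- advance: both sides are the segment from `L[i k]` to `L[i k + 1]`
    have e1 : AffineMap.lineMap (i k : ℝ) (i (k + 1) : ℝ) u = (i k : ℝ) + u := by
      rw [hnext, AffineMap.lineMap_apply_module, smul_eq_mul, smul_eq_mul]; push_cast; ring
    rw [e1]
    have hik1 : i k + 1 < L.length := by have := hlt (k + 1) hkK; rw [hnext] at this; exact this
    rw [affineInterp_eq_lineMap L (i k) hik1 ⟨by linarith [hu01.1], by linarith [hu01.2]⟩,
      add_sub_cancel_left]
    simp only [hnext]

/-! ### The discrete Fréchet bound for two polylines -/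

/-- **Discrete Fréchet bound.** If the knots of two polylines can be traversed simultaneously
along unit-step index sequences `i`, `j` (from the first to the last knots) keeping the current
knots within distance `r`, the two polylines are within `r` as curve classes: stutter both knot
lists along the coupling (`siteEnd_mk_polyline_stutter`) and compare the two equally long
interpolations knot by knot (`siteEnd_dist_affineInterp_le`). -/
theorem siteEnd_dist_mk_polyline_le_of_coupling {P Q : List E} (hP : P ≠ []) (hQ : Q ≠ [])
    {K : ℕ} {i j : ℕ → ℕ} (hi0 : i 0 = 0) (hj0 : j 0 = 0) (hiK : i K = P.length - 1)
    (hjK : j K = Q.length - 1) (histep : ∀ k < K, i (k + 1) = i k ∨ i (k + 1) = i k + 1)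
    (hjstep : ∀ k < K, j (k + 1) = j k ∨ j (k + 1) = j k + 1) (hilt : ∀ k ≤ K, i k < P.length)
    (hjlt : ∀ k ≤ K, j k < Q.length) {r : ℝ} (hr : 0 ≤ r)
    (hdist : ∀ (k : ℕ) (hk : k ≤ K), dist (P[i k]'(hilt k hk)) (Q[j k]'(hjlt k hk)) ≤ r) :
    dist (CurveClass.mk (⟨polyline P⟩ : Curve E)) (CurveClass.mk ⟨polyline Q⟩) ≤ r := by
  rw [siteEnd_mk_polyline_stutter hP hi0 hiK histep hilt, siteEnd_mk_polyline_stutter hQ hj0 hjK hjstep hjlt,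
    mk_polyline_eq_mk_uniformCurve, mk_polyline_eq_mk_uniformCurve, CurveClass.dist_mk_mk]
  refine (Curve.dist_le_dist_toContinuousMap _ _).trans ((ContinuousMap.dist_le hr).2 fun t => ?_)
  change dist (uniformCurve _ t) (uniformCurve _ t) ≤ r
  rw [uniformCurve_apply, uniformCurve_apply, List.length_ofFn, List.length_ofFn]
  refine siteEnd_dist_affineInterp_le _ _ (by simp) hr (fun k hk hk' => ?_)
    (mul_nonneg (by push_cast; linarith) t.2.1)
  simp only [List.getElem_ofFn]
  exact hdist k (by simp at hk; omega)

end Interp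

/-! ### The discrete Fréchet bound for closed honeycomb walks at two meshes -/

/-- **DKKMO's distance between the unbased loops of two closed honeycomb walks, drawn at meshes
`δ₁` and `δ₂`, is at most `r` as soon as their vertex lists can be traversed simultaneously
(unit steps, from the base faces to the base faces) keeping the current rescaled face centres
within `r`** (`udist ≤` distance of curve classes, `udist_mk_mk_le_dist`, and the discrete
Fréchet bound `siteEnd_dist_mk_polyline_le_of_coupling`). This is the metric packaging for the
fellow-travelling of a coarse interface loop and a fine interface loop. -/
theorem siteEnd_udist_siteLoopCurve_le_of_coupling : ∀ {f₁ f₂ : HexVertex} (w₁ : hexGraph.Walk f₁ f₁)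
    (w₂ : hexGraph.Walk f₂ f₂) (δ₁ δ₂ : ℝ) {K : ℕ} {i j : ℕ → ℕ}, i 0 = 0 → j 0 = 0 →
    i K = w₁.length → j K = w₂.length →
    (∀ k < K, i (k + 1) = i k ∨ i (k + 1) = i k + 1) →
    (∀ k < K, j (k + 1) = j k ∨ j (k + 1) = j k + 1) → ∀ {r : ℝ}, 0 ≤ r →
    (∀ k ≤ K, dist ((δ₁ : ℂ) * hexCenter (w₁.getVert (i k)))
      ((δ₂ : ℂ) * hexCenter (w₂.getVert (j k))) ≤ r) →
    (UnbasedLoop.mk (BasedLoop.mk (siteLoopCurve δ₁ w₁) (isLoop_siteLoopCurve δ₁ w₁))).udist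
      (UnbasedLoop.mk (BasedLoop.mk (siteLoopCurve δ₂ w₂) (isLoop_siteLoopCurve δ₂ w₂))) ≤ r := by
  intro f₁ f₂ w₁ w₂ δ₁ δ₂ K i j hi0 hj0 hiK hjK histep hjstep r hr hdist
  refine (udist_mk_mk_le_dist _ _).trans ?_
  -- index bounds from the unit steps
  have hile : ∀ k ≤ K, i k ≤ w₁.length := by
    intro k hk
    have key : ∀ n, k + n = K → i k ≤ i K := by
      intro n
      induction n generalizing k with
      | zero => intro h; rw [Nat.add_zero] at h; rw [h]
      | succ n ih' =>
        intro h
        have h1 : i k ≤ i (k + 1) := by rcases histep k (by omega) with h' | h' <;> omega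
        exact h1.trans (ih' (k + 1) (by omega) (by omega))
    exact hiK ▸ key (K - k) (by omega)
  have hjle : ∀ k ≤ K, j k ≤ w₂.length := by
    intro k hk
    have key : ∀ n, k + n = K → j k ≤ j K := by
      intro n
      induction n generalizing k with
      | zero => intro h; rw [Nat.add_zero] at h; rw [h]
      | succ n ih' =>
        intro h
        have h1 : j k ≤ j (k + 1) := by rcases hjstep k (by omega) with h' | h' <;> omega
        exact h1.trans (ih' (k + 1) (by omega) (by omega))
    exact hjK ▸ key (K - k) (by omega)
  have hilt : ∀ k ≤ K, i k < (w₁.support.map fun v => (δ₁ : ℂ) * hexCenter v).length := fun k hk => by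
    rw [List.length_map, SimpleGraph.Walk.length_support]; exact Nat.lt_succ_of_le (hile k hk)
  have hjlt : ∀ k ≤ K, j k < (w₂.support.map fun v => (δ₂ : ℂ) * hexCenter v).length := fun k hk => by
    rw [List.length_map, SimpleGraph.Walk.length_support]; exact Nat.lt_succ_of_le (hjle k hk)
  change dist (CurveClass.mk (⟨polyline (w₁.support.map fun v => (δ₁ : ℂ) * hexCenter v)⟩ : Curve ℂ))
    (CurveClass.mk ⟨polyline (w₂.support.map fun v => (δ₂ : ℂ) * hexCenter v)⟩) ≤ r
  refine siteEnd_dist_mk_polyline_le_of_coupling (by simp) (by simp) hi0 hj0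
    (by rw [List.length_map, SimpleGraph.Walk.length_support]; omega)
    (by rw [List.length_map, SimpleGraph.Walk.length_support]; omega) histep hjstep hilt hjlt hr
    fun k hk => ?_
  simp only [List.getElem_map]
  rw [SimpleGraph.Walk.support_getElem_eq_getVert, SimpleGraph.Walk.support_getElem_eq_getVert]
  exact hdist k hk

end Summit.CriticalPhenomena.CardyFormulaZ2.Cruxes.LoopLimitZ2EqT.HexSegment

end
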